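import Literature.NumberTheory.EllipticCurves.BurungaleSkinner2023.Curve14a1TwistsCertificate
import HarnessLib

/-!
# Burungale–Skinner 2023, Example (E5): the hypotheses of Theorem 2.10 for `26b2` at `p = 7`,
# `ℓ₀ = 13`, `ψ₀ = ψ_{ℚ(√−2)}`, KERNEL-CHECKED

A. Burungale, C. Skinner, Proc. AMS Ser. B 10 (2023), p. 24, Example (E5): "The elliptic curve 26b2
on the LMFDB list, which has minimal Weierstrass equation `E : y² + xy + y = x³ − x² − 3x + 3`, has
a rational point of order `7`. In this case `S = {2}`, `N = {13}` and `ϕ = 1`. Note that `r₁₃ = 1`,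
so we may take `ℓ₀ = 13`. Let `ψ₀` be the quadratic character associated with the field
`K₀ = ℚ(√−2)`. Then `ψ₀(7) = −1 = ψ₀(13)`. As `h_{K₀} = 2` [sic: `h(ℚ(√−2)) = 1`; either way
`7 ∤ h_{K₀}`], it follows that `ψ₀` satisfies the conditions of Theorem 2.10 and so the conclusions
of that theorem hold for `E^{ψ₀}`."

Certified here, hypothesis by hypothesis (`Thm210Hypotheses c26b2 7 Φ 13 K K`, `d_K = −8`):
`M26b2 = [1,−1,1,−3,3]`, `Δ = −1664 = −2⁷·13`, `c₄ = 129` (coprime: semistable), `N = 26`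
(`conductorNorm_c26b2`, the semistable toolkit of `Curve14a1TwistsCertificate.lean`), global
minimality (`|Δ| < 2¹²`), multiplicative at `2` and `13`, NON-split at `13` (the node-tangent
quadratic `12X² + 12X − 8` has no root in `𝔽₁₃`), good outside `{2, 13}`; the point `P₇ = (1, 0)` of
order `7` (`2P₇ = (−1,−2)`, `4P₇ = (3,2)`, `8P₇ = P₇`), the line `Φ = ⟨P̄₇⟩` (`ϕ = 1`); `r₁₃ = 1`
(`numPrimesAbove_seven_thirteen`); field side for `d_K = −8`: `7 ∤ 8`, `(−8/13) = −1` (`13` inert: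
(a) with `13 ∈ N`), `2 ∣ d_K` (`ψ₀` ramified at `2`: (b), (c) at `ℓ = 2 ∈ S`), `(−8/7) = −1`
((d): `7` inert in `K' = K`), `h(−8) = 1` ((e)). Hence `twistConclusion_c26b2_neg_eight`:
**modulo `thm210_twist_rankOne_nondegenerate`, `rank E^{(−8)}(ℚ) = ord_{s=1} L(E^{(−8)}, s) = 1`,
`λ = 1`, and the `7`-adic height on every global minimal model of `E^{(−8)}` is non-degenerate**
(`E = 26b2`, `E^{(−8)} = E^{ψ₀}`). Definitions with bodies + theorems; no new facts.

References: [BurungaleSkinner2023] Example (E5) (p. 24), Thm. 2.10 (p. 23); [CremonaAlgorithms1997]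
Table 1, `N = 26`; [SilvermanAEC2009] VII.1 Rem. 1.1, VII.5 Prop. 5.1; [Silverman1994] IV.10.2;
[Marcus2018] Ch. 3 Thm. 25.
-/

noncomputable section

open scoped Classical

open NumberField IsDedekindDomain IsDedekindDomain.HeightOneSpectrum WeierstrassCurve Polynomial
  Literature.NumberTheory.EllipticCurves Literature.NumberTheory.EllipticCurves.Rank1Residual
  Literature.NumberTheory.QuadraticFields.Quadratic

namespace Literature.NumberTheory.EllipticCurves.BurungaleSkinner2023

/-! ### §1 The curve `26b2 = [1, −1, 1, −3, 3]` -/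

/-- LMFDB `26.b2` (Cremona `26b1`…`b2` class `26b`): `[1, −1, 1, −3, 3]` as an integer model.
[cite: BurungaleSkinner2023, Example (E5) (p. 24)] -/
abbrev M26b2 : WeierstrassCurve ℤ := ⟨1, -1, 1, -3, 3⟩

/-- `26b2 / ℚ`. [cite: BurungaleSkinner2023, Example (E5) (p. 24)] -/
abbrev c26b2 : WeierstrassCurve ℚ := M26b2.baseChange ℚ

/-- `Δ(26b2) = −1664 = −2⁷·13`. [cite: CremonaAlgorithms1997, Table 1, N = 26] -/
theorem M26b2_Δ : M26b2.Δ = -1664 := by decide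

/-- `c₄(26b2) = 129`. [cite: CremonaAlgorithms1997, Table 1, N = 26] -/
theorem M26b2_c₄ : M26b2.c₄ = 129 := by decide

/-- `26b2` is an elliptic curve. [cite: CremonaAlgorithms1997, Table 1, N = 26] -/
theorem isElliptic_c26b2 : c26b2.IsElliptic := by
  rw [WeierstrassCurve.isElliptic_iff, baseChange_int_Δ, M26b2_Δ]; norm_num

/-- The model `[1,−1,1,−3,3]` is globally minimal (`|Δ| = 1664 < 2¹²`). [cite: SilvermanAEC2009, VII.1 Remark 1.1] -/
theorem isGloballyMinimal_c26b2 : c26b2.IsGloballyMinimal :=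
  isGloballyMinimal_baseChange_int M26b2 (forall_not_pow_dvd_or_of_bound M26b2 (B := 2)
    (by rw [M26b2_Δ]; decide) (by rw [M26b2_Δ]; decide) (by
      intro p hp hpr
      have hp2 : p < 2 := Finset.mem_range.mp hp
      interval_cases p <;> exact absurd hpr (by decide)))

/-- `Δ(26b2)` and `c₄(26b2)` are coprime (semistable). [cite: SilvermanAEC2009, VII.5 Prop. 5.1(b)] -/
theorem M26b2_coprime : IsCoprime M26b2.Δ M26b2.c₄ := by
  rw [M26b2_Δ, M26b2_c₄, Int.isCoprime_iff_gcd_eq_one]; decide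

/-- **The conductor of `26b2` is `26 = 2·13`.** [cite: CremonaAlgorithms1997, Table 1, N = 26] -/
theorem conductorNorm_c26b2 : c26b2.conductorNorm ℤ = 26 := by
  haveI := isElliptic_c26b2
  refine conductorNorm_baseChange_int_of_isCoprime M26b2 M26b2_coprime (k := 7) ?_ ?_ ?_
  · rw [Nat.squarefree_iff_nodup_primeFactorsList (by norm_num)]; simp
  · rw [M26b2_Δ]; decide
  · rw [M26b2_Δ]; decide

/-- `26b2` is multiplicative at `13` (`13 ∉ A`). [cite: SilvermanAEC2009, VII.5 Prop. 5.1(b)] -/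
theorem hasMultiplicativeReductionAtPrime_c26b2_thirteen [Fact (Nat.Prime 13)] :
    c26b2.HasMultiplicativeReductionAtPrime 13 := by
  haveI := isElliptic_c26b2
  exact hasMultiplicativeReductionAtPrime_baseChange_int_of_isCoprime M26b2 M26b2_coprime
    (by rw [M26b2_Δ]; decide)

/-- `26b2` has good reduction at every prime `ℓ ∉ {2, 13}`. [cite: SilvermanAEC2009, VII.5 Prop. 5.1(a)] -/
theorem hasGoodReductionAtPrime_c26b2 {ℓ : ℕ} [hℓ : Fact ℓ.Prime] (h2 : ℓ ≠ 2) (h13 : ℓ ≠ 13) :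
    c26b2.HasGoodReductionAtPrime ℓ := by
  haveI := isElliptic_c26b2
  refine hasGoodReductionAtPrime_baseChange_int_of_not_dvd M26b2 ?_
  rw [M26b2_Δ]
  intro hd
  have hd' : ℓ ∣ 2 ^ 7 * 13 := by exact_mod_cast Int.dvd_neg.mp hd
  rcases (Nat.Prime.dvd_mul hℓ.out).mp hd' with h | h
  · exact h2 ((Nat.prime_dvd_prime_iff_eq hℓ.out Nat.prime_two).mp (hℓ.out.dvd_of_dvd_pow h))
  · exact h13 ((Nat.prime_dvd_prime_iff_eq hℓ.out (by norm_num)).mp h)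

/-- `26b2 mod 13 = [1, 12, 1, 10, 3]`. [cite: CremonaAlgorithms1997, Table 1, N = 26] -/
theorem M26b2_mod_thirteen : M26b2.map (Int.castRingHom (ZMod 13)) = ⟨1, 12, 1, 10, 3⟩ := by
  ext <;> decide

/-- A quadratic over `𝔽₁₃` with no root in `𝔽₁₃` does not split. [folklore] -/
private theorem not_splits_quadratic_F13 {a b c : ZMod 13} (ha : a ≠ 0)
    (h : ∀ r : ZMod 13, a * r ^ 2 + b * r + c ≠ 0) : ¬ (C a * X ^ 2 + C b * X + C c).Splits := by
  intro hs
  have hdeg : (C a * X ^ 2 + C b * X + C c).degree ≠ 0 := by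
    rw [Polynomial.degree_quadratic ha]; decide
  obtain ⟨r, hr⟩ := hs.exists_eval_eq_zero hdeg
  have hr' : a * r ^ 2 + b * r + c = 0 := by
    simpa [eval_add, eval_mul, eval_pow, eval_C, eval_X] using hr
  exact h r hr'

/-- `c₄`, `b₂`, `b₄`, `b₆` of `26b2 mod 13`. [folklore] -/
private theorem invariants_mod_thirteen :
    (⟨1, 12, 1, 10, 3⟩ : WeierstrassCurve (ZMod 13)).c₄ = 12 ∧
      (⟨1, 12, 1, 10, 3⟩ : WeierstrassCurve (ZMod 13)).b₂ = 10 ∧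
      (⟨1, 12, 1, 10, 3⟩ : WeierstrassCurve (ZMod 13)).b₄ = 8 ∧
      (⟨1, 12, 1, 10, 3⟩ : WeierstrassCurve (ZMod 13)).b₆ = 0 := by
  refine ⟨by decide, by decide, by decide, by decide⟩

/-- The node-tangent quadratic `12X² + 12X − 8` of `26b2 mod 13` has no root in `𝔽₁₃`. [folklore] -/
private theorem nodeQuadratic_mod_thirteen_ne_zero :
    ∀ r : ZMod 13, 12 * r ^ 2 + 1 * 12 * r + -(54 * 0 - 3 * 10 * 8 + 12 * 12) ≠ 0 := by decide

/-- **`26b2` is NON-SPLIT multiplicative at `13`** (`13 ∈ N`): the node-tangent quadratic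
`12X² + 12X − 8` has no root in `𝔽₁₃`. [cite: BurungaleSkinner2023, Example (E5) (p. 24) ("N = {13}")] -/
theorem not_hasSplitMultiplicativeReductionAtPrime_c26b2_thirteen [Fact (Nat.Prime 13)] :
    ¬ c26b2.HasSplitMultiplicativeReductionAtPrime 13 := by
  haveI := isElliptic_c26b2
  haveI := isGloballyMinimal_c26b2
  have hint : integralModelInt c26b2 = M26b2 := integralModelInt_baseChange_int M26b2
  have hΔ : ((13 : ℕ) : ℤ) ∣ (integralModelInt c26b2).Δ := by rw [hint, M26b2_Δ]; decide
  have hc₄ : ¬ ((13 : ℕ) : ℤ) ∣ (integralModelInt c26b2).c₄ := by rw [hint, M26b2_c₄]; decide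
  rw [LocalTorsionMult.hasSplitMultiplicativeReductionAtPrime_iff_splits_integralModelInt c26b2 13 hΔ
    hc₄, hint, M26b2_mod_thirteen]
  obtain ⟨e1, e2, e3, e4⟩ := invariants_mod_thirteen
  dsimp only
  rw [e1, e2, e3, e4, sub_eq_add_neg, ← C_neg]
  exact not_splits_quadratic_F13 (by decide) nodeQuadratic_mod_thirteen_ne_zero

/-! ### §2 The point `P₇ = (1, 0)` of order `7` and the line `Φ = ⟨P̄₇⟩` -/

/-- The coefficients of `26b2 / ℚ`. [cite: BurungaleSkinner2023, Example (E5) (p. 24)] -/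
theorem c26b2_eq : c26b2 = ⟨1, -1, 1, -3, 3⟩ := by
  ext <;> simp [WeierstrassCurve.baseChange, WeierstrassCurve.map]

/-- Nonsingularity of a rational affine point of `26b2` from its coordinates. [folklore] -/
private theorem nonsingular_c26b2 {x y : ℚ} (h₁ : y ^ 2 + x * y + y = x ^ 3 - x ^ 2 - 3 * x + 3)
    (h₂ : 2 * y + x + 1 ≠ 0) : c26b2.toAffine.Nonsingular x y := by
  refine (Affine.nonsingular_iff' _ _).mpr ⟨(Affine.equation_iff _ _).mpr ?_, Or.inr ?_⟩
  · rw [c26b2_eq]; norm_num; linear_combination h₁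
  · rw [c26b2_eq]; norm_num; intro h; exact h₂ (by linear_combination h)

/-- `P₇ = (1, 0) ∈ 26b2(ℚ)`, "a rational point of order `7`". [cite: BurungaleSkinner2023, Example (E5) (p. 24)] -/
def P₇ : c26b2.toAffine.Point :=
  Affine.Point.some 1 0 (nonsingular_c26b2 (by norm_num) (by norm_num))

/-- `P₇ ≠ O`. [cite: BurungaleSkinner2023, Example (E5) (p. 24)] -/
theorem P₇_ne_zero : P₇ ≠ 0 := Affine.Point.some_ne_zero _

/-- `2P₇ = (−1, −2)`. [cite: BurungaleSkinner2023, Example (E5) (p. 24)] -/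
theorem P₇_add_P₇ [DecidableEq ℚ] :
    P₇ + P₇ = Affine.Point.some (-1) (-2) (nonsingular_c26b2 (by norm_num) (by norm_num)) := by
  have hy : (0 : ℚ) ≠ c26b2.toAffine.negY 1 0 := by rw [c26b2_eq]; norm_num [Affine.negY]
  unfold P₇
  rw [Affine.Point.add_self_of_Y_ne hy]
  congr 1
  · rw [Affine.slope_of_Y_ne rfl hy, c26b2_eq]
    norm_num [Affine.addX, Affine.negY]
  · rw [Affine.slope_of_Y_ne rfl hy, c26b2_eq]
    norm_num [Affine.addY, Affine.negAddY, Affine.addX, Affine.negY]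

/-- `2(−1, −2) = (3, 2)` (`= 4P₇`). [cite: BurungaleSkinner2023, Example (E5) (p. 24)] -/
theorem twoP₇_add_twoP₇ [DecidableEq ℚ] :
    Affine.Point.some (W' := c26b2.toAffine) (-1) (-2) (nonsingular_c26b2 (by norm_num) (by norm_num)) +
        Affine.Point.some (-1) (-2) (nonsingular_c26b2 (by norm_num) (by norm_num)) =
      Affine.Point.some 3 2 (nonsingular_c26b2 (by norm_num) (by norm_num)) := by
  have hy : (-2 : ℚ) ≠ c26b2.toAffine.negY (-1) (-2) := by rw [c26b2_eq]; norm_num [Affine.negY]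
  rw [Affine.Point.add_self_of_Y_ne hy]
  congr 1
  · rw [Affine.slope_of_Y_ne rfl hy, c26b2_eq]
    norm_num [Affine.addX, Affine.negY]
  · rw [Affine.slope_of_Y_ne rfl hy, c26b2_eq]
    norm_num [Affine.addY, Affine.negAddY, Affine.addX, Affine.negY]

/-- `2(3, 2) = (1, 0) = P₇` (`8P₇ = P₇`). [cite: BurungaleSkinner2023, Example (E5) (p. 24)] -/
theorem fourP₇_add_fourP₇ [DecidableEq ℚ] :
    Affine.Point.some (W' := c26b2.toAffine) 3 2 (nonsingular_c26b2 (by norm_num) (by norm_num)) +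
        Affine.Point.some 3 2 (nonsingular_c26b2 (by norm_num) (by norm_num)) = P₇ := by
  have hy : (2 : ℚ) ≠ c26b2.toAffine.negY 3 2 := by rw [c26b2_eq]; norm_num [Affine.negY]
  unfold P₇
  rw [Affine.Point.add_self_of_Y_ne hy]
  congr 1
  · rw [Affine.slope_of_Y_ne rfl hy, c26b2_eq]
    norm_num [Affine.addX, Affine.negY]
  · rw [Affine.slope_of_Y_ne rfl hy, c26b2_eq]
    norm_num [Affine.addY, Affine.negAddY, Affine.addX, Affine.negY]

/-- **`7 P₇ = O`** (`8P₇ = P₇`). [cite: BurungaleSkinner2023, Example (E5) (p. 24)] -/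
theorem seven_nsmul_P₇ [DecidableEq ℚ] : (7 : ℕ) • P₇ = 0 := by
  have h2 : (2 : ℕ) • P₇ = Affine.Point.some (-1) (-2) (nonsingular_c26b2 (by norm_num) (by norm_num)) := by
    rw [two_nsmul, P₇_add_P₇]
  have h4 : (2 * 2 : ℕ) • P₇ = Affine.Point.some 3 2 (nonsingular_c26b2 (by norm_num) (by norm_num)) := by
    rw [mul_nsmul, h2, two_nsmul, twoP₇_add_twoP₇]
  have h8 : (2 * 2 * 2 : ℕ) • P₇ = P₇ := by
    rw [mul_nsmul, h4, two_nsmul, fourP₇_add_fourP₇]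
  have h8' : (7 + 1 : ℕ) • P₇ = P₇ := h8
  rw [succ_nsmul] at h8'
  exact add_right_cancel (h8'.trans (zero_add P₇).symm)

/-- The geometric point `P̄₇ ∈ 26b2(ℚ̄)` (spelled with Mathlib's `Affine.Point.map`; definitionally
`toGeomPoints c26b2 P₇`). [cite: SilvermanAEC2009, VIII.§1] -/
def P₇bar : geomPoints c26b2 :=
  Affine.Point.map (W' := c26b2.toAffine) (S := ℚ) (Algebra.ofId ℚ (AlgebraicClosure ℚ)) P₇

/-- `P̄₇ = toGeomPoints c26b2 P₇`. [cite: SilvermanAEC2009, VIII.§1] -/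
theorem toGeomPoints_P₇ : toGeomPoints c26b2 P₇ = P₇bar := rfl

/-- `7 P̄₇ = O`. [cite: BurungaleSkinner2023, Example (E5) (p. 24)] -/
theorem seven_nsmul_P₇bar : (7 : ℕ) • P₇bar = 0 := by
  have h := map_nsmul (Affine.Point.map (W' := c26b2.toAffine) (S := ℚ)
    (Algebra.ofId ℚ (AlgebraicClosure ℚ))) 7 P₇
  rw [seven_nsmul_P₇, map_zero] at h
  exact h.symm

/-- `P̄₇ ≠ O`. [cite: BurungaleSkinner2023, Example (E5) (p. 24)] -/
theorem P₇bar_ne_zero : P₇bar ≠ 0 := fun h =>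
  P₇_ne_zero (Affine.Point.map_injective (W' := c26b2.toAffine)
    (f := Algebra.ofId ℚ (AlgebraicClosure ℚ)) (h.trans (map_zero _).symm))

/-- `P̄₇` is `Γ_ℚ`-fixed. [cite: SilvermanAEC2009, VIII.§1] -/
theorem smul_P₇bar (σ : Field.absoluteGaloisGroup ℚ) : σ • P₇bar = P₇bar :=
  smul_toGeomPoints c26b2 σ P₇

/-- `P̄₇ ∈ E[7]`. [cite: BurungaleSkinner2023, Example (E5) (p. 24)] -/
theorem P₇bar_mem_geomTorsion : P₇bar ∈ geomTorsion c26b2 ((7 : ℕ) : ℤ) := by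
  rw [mem_torsionBy_iff, natCast_zsmul]
  exact seven_nsmul_P₇bar

/-- `P̄₇` has order exactly `7`. [cite: BurungaleSkinner2023, Example (E5) (p. 24)] -/
theorem addOrderOf_P₇bar [Fact (Nat.Prime 7)] : addOrderOf P₇bar = 7 :=
  addOrderOf_eq_prime seven_nsmul_P₇bar P₇bar_ne_zero

/-- **The rational `7`-torsion line `Φ = ⟨P̄₇⟩ ≤ E[7]` of `26b2`** (`7` elements, `ϕ = 1`).
[cite: BurungaleSkinner2023, Example (E5) (p. 24) ("ϕ = 1")] -/
theorem line_c26b2 [Fact (Nat.Prime 7)] :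
    ∃ Φ : AddSubgroup (geomTorsion c26b2 ((7 : ℕ) : ℤ)),
      Nat.card Φ = 7 ∧ ∀ (σ : Field.absoluteGaloisGroup ℚ), ∀ P ∈ Φ, σ • P = P := by
  set Tt : geomTorsion c26b2 ((7 : ℕ) : ℤ) := ⟨P₇bar, P₇bar_mem_geomTorsion⟩ with hTt
  have hfix : ∀ σ : Field.absoluteGaloisGroup ℚ, σ • Tt = Tt := fun σ =>
    Subtype.ext (smul_P₇bar σ)
  have hord : addOrderOf Tt = 7 := by
    rw [← AddSubgroup.addOrderOf_coe]
    exact addOrderOf_P₇bar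
  refine ⟨AddSubgroup.zmultiples Tt, ?_, ?_⟩
  · rw [Nat.card_zmultiples, hord]
  · intro σ P hP
    obtain ⟨k, rfl⟩ := AddSubgroup.mem_zmultiples_iff.mp hP
    rw [smul_comm σ k Tt, hfix]

/-! ### §3 Theorem 2.10 for `(26b2, p = 7, ℓ₀ = 13, ψ₀ = ψ_{ℚ(√−2)})` -/

/-- `−8 = d_{ℚ(√−2)}` is the discriminant of an imaginary quadratic field. [cite: Cox2013, §5.B] -/
theorem isOddQuadraticCharDiscr_neg_eight : IsOddQuadraticCharDiscr (-8) := by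
  refine isOddQuadraticCharDiscr_iff.mpr ⟨Or.inr ⟨⟨-2, by norm_num⟩, by decide, ?_⟩, by norm_num⟩
  rw [show (-8 : ℤ) / 4 = -2 by decide, ← Int.squarefree_natAbs]
  exact Nat.squarefree_two

/-- **All hypotheses of Thm. 2.10 for `(26b2, 7, Φ = ⟨P̄₇⟩, ℓ₀ = 13, K = K' = an imaginary quadratic
field of discriminant −8 = d_{ℚ(√−2)})`**: `7 ∤ 6·26`; `ϕ = 1`; `13 ∣ 26`, `13 ∉ A`, `r₁₃ = 1`;
`7 ∤ 8`; (a) `13 ∈ N`, `ψ₀(13) = −1` (`(−8/13) = −1`; `26b2` is not split at `13`); (b), (c) at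
`2 ∈ S`: `ψ₀` is ramified at `2` (`2 ∣ d_K`); (d) `ψ₀(7) = −1` (`(−8/7) = −1`); (e) `h(−8) = 1`.
[cite: BurungaleSkinner2023, Example (E5) (p. 24) with Thm. 2.10 (p. 23)] -/
theorem thm210Hypotheses_c26b2_of_discr_eq_neg_eight [Fact (Nat.Prime 7)] [Fact (Nat.Prime 13)]
    (K : Type) [Field K] [NumberField K] (hK : IsImaginaryQuadratic K)
    (hd : NumberField.discr K = -8) :
    haveI := isGloballyMinimal_c26b2
    ∃ Φ : AddSubgroup (geomTorsion c26b2 ((7 : ℕ) : ℤ)), Thm210Hypotheses c26b2 7 Φ 13 K K := by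
  haveI := isElliptic_c26b2
  haveI := isGloballyMinimal_c26b2
  obtain ⟨Φ, hcard, htriv⟩ := line_c26b2
  have hgood : ∀ (ℓ : ℕ) [Fact ℓ.Prime], ℓ ≠ 13 → ℓ ≠ 2 → ¬ c26b2.HasMultiplicativeReductionAtPrime ℓ :=
    fun ℓ _ h13 h2 => (hasGoodReductionAtPrime_c26b2 h2 h13).not_hasMultiplicativeReduction
  refine ⟨Φ, ?_⟩
  exact {
    not_dvd_six_mul_conductor := by rw [conductorNorm_c26b2]; decide
    isRationalLine := ⟨hcard, fun σ P hP => by rw [htriv σ P hP]; exact hP⟩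
    lineOrderDvdTwo := lineOrderDvdTwo_of_forall_smul_eq htriv
    lineEven := lineEven_of_forall_smul_eq htriv
    lineUnramifiedAt := lineUnramifiedAt_of_forall_smul_eq htriv
    ell0_dvd_conductor := by rw [conductorNorm_c26b2]; decide
    mult_ell0 := hasMultiplicativeReductionAtPrime_c26b2_thirteen
    numPrimesAbove_ell0 := numPrimesAbove_seven_thirteen
    isImaginaryQuadratic := hK
    isImaginaryQuadratic' := hK
    isProductCharacterField := isProductCharacterField_self_of_isImaginaryQuadratic htriv K hK
    not_dvd_discr := by rw [hd]; decide
    lineUnramifiedAt_of_dvd_discr := fun ℓ _ _ => lineUnramifiedAtPrime_of_forall_smul_eq htriv ℓ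
    a_split := fun hs => absurd hs not_hasSplitMultiplicativeReductionAtPrime_c26b2_thirteen
    a_nonsplit := fun _ => isInertIn_of_legendreSym_eq_neg_one hK.1 (by rw [hd]; norm_num)
    b := by
      intro ℓ _ h13 hs
      by_cases h2 : ℓ = 2
      · subst h2; exact Or.inl (by rw [hd]; decide)
      · exact absurd hs.hasMultiplicativeReductionAtPrime (hgood ℓ h13 h2)
    c := by
      intro ℓ _ h13 hm _
      by_cases h2 : ℓ = 2
      · subst h2; exact Or.inl (by rw [hd]; decide)
      · exact absurd hm (hgood ℓ h13 h2)
    d := isInertIn_of_legendreSym_eq_neg_one hK.1 (by rw [hd]; norm_num)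
    e := by rw [classNumber_eq_one_of_discr_mem hK.1 (by rw [hd]; decide)]; decide }

/-- **The `ψ₀ = ψ_{ℚ(√−2)}` twist of `26b2` (`d = −8`), modulo Thm. 2.10 by name**: granting
`thm210_twist_rankOne_nondegenerate`, `rank E^{(−8)}(ℚ) = ord_{s=1} L(E^{(−8)}, s) = 1`,
`λ(L_{E^{(−8)}}) = 1`, and the `7`-adic height pairing on every global minimal model of `E^{(−8)}` is
NON-DEGENERATE — every hypothesis kernel-checked ("so the conclusions of that theorem hold for
`E^{ψ₀}`"). [cite: BurungaleSkinner2023, Example (E5) (p. 24)] -/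
theorem twistConclusion_c26b2_neg_eight [Fact (Nat.Prime 7)] [Fact (Nat.Prime 13)]
    (h : thm210_twist_rankOne_nondegenerate) :
    haveI := isElliptic_c26b2
    haveI := isGloballyMinimal_c26b2
    TwistConclusion c26b2 7 (-8) := by
  haveI := isElliptic_c26b2
  haveI := isGloballyMinimal_c26b2
  obtain ⟨K, _, _, hK, hd⟩ := isOddQuadraticCharDiscr_neg_eight
  obtain ⟨Φ, hΦ⟩ := thm210Hypotheses_c26b2_of_discr_eq_neg_eight K hK hd
  have hc := h c26b2 7 Φ 13 K K hΦ
  rwa [hd] at hc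

/-- **The `7`-part of BSD for the `−8` twist of `26b2`, modulo Thm. 3.1 by name.**
[cite: BurungaleSkinner2023, Thm. 3.1 (p. 25) with Example (E5) (p. 24)] -/
theorem pPartBSD_twist_c26b2_neg_eight [Fact (Nat.Prime 7)] [Fact (Nat.Prime 13)]
    (h : thm31_twist_pPartBSD_rankOne) :
    haveI := isElliptic_c26b2
    (c26b2.quadraticTwist ((-8 : ℤ) : ℚ)).analyticRank = 1 ∧
      ∀ (W' : WeierstrassCurve ℚ) [W'.IsElliptic] [W'.IsGloballyMinimal] (C : VariableChange ℚ),
        C • c26b2.quadraticTwist ((-8 : ℤ) : ℚ) = W' → PPartRankOnePrintShape W' 7 := by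
  haveI := isElliptic_c26b2
  haveI := isGloballyMinimal_c26b2
  obtain ⟨K, _, _, hK, hd⟩ := isOddQuadraticCharDiscr_neg_eight
  obtain ⟨Φ, hΦ⟩ := thm210Hypotheses_c26b2_of_discr_eq_neg_eight K hK hd
  have hc := h c26b2 7 13 K K (Or.inr ⟨Φ, hΦ⟩)
  rwa [hd] at hc

end Literature.NumberTheory.EllipticCurves.BurungaleSkinner2023

end
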